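import Summits.HubbardSuperconductivity.HubbardSuperconductivity.Theses.JosephsonMirror
import Summits.HubbardSuperconductivity.HubbardSuperconductivity.Theorems.JosephsonMirrorJmInterchangeWindowPigeonhole
import Summits.HubbardSuperconductivity.HubbardSuperconductivity.Theorems.JosephsonMirrorJmInterchangeCouplingBound
import Summits.HubbardSuperconductivity.HubbardSuperconductivity.Theorems.JosephsonMirrorJmInterchangeHypGivesZEPO
import Summits.HubbardSuperconductivity.HubbardSuperconductivity.Theorems.JosephsonMirrorJmInterchangeBridge
import Summits.HubbardSuperconductivity.HubbardSuperconductivity.Theorems.JosephsonMirrorJmInterchangeBridgeApprox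
import Summits.HubbardSuperconductivity.HubbardSuperconductivity.Theorems.JosephsonMirrorJmInterchangeZepoGivesHyp
import Summits.HubbardSuperconductivity.HubbardSuperconductivity.Theorems.JosephsonMirrorJmInterchangeNormalForm
import Summits.HubbardSuperconductivity.HubbardSuperconductivity.Theorems.JosephsonMirrorJmInterchangeResidualNecessity
import Summits.HubbardSuperconductivity.HubbardSuperconductivity.Theorems.JosephsonMirrorJmInterchangeExactResidues
import Summits.HubbardSuperconductivity.HubbardSuperconductivity.Theorems.JosephsonMirrorJmInterchangeRateForm
import Summits.HubbardSuperconductivity.HubbardSuperconductivity.Theorems.JosephsonMirrorJmInterchangeUniformOnset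
import Summits.HubbardSuperconductivity.HubbardSuperconductivity.Theorems.JosephsonMirrorJmInterchangeCouplingRange
import Summits.HubbardSuperconductivity.HubbardSuperconductivity.Theorems.JmInterchange.Negative.JmInterchangeFalseOfZepoFloorMismatch

/-!
# Line `Sketch` — crux stmt-HubbardSuperconductivity-2227 (`JosephsonMirror.JmInterchange`)

Lead's skeleton (owned copy of `Cruxes/JmInterchange/SketchIdeator1.lean`, idea card
`strip-the-mirror-pair-removal-bridge`).  Sorries only in `stub_*`; `JmInterchange_of` concludes the
crux BY NAME.

§1  NORMAL FORM.  `GainHyp` / `FloorBridge` are the hypothesis / conclusion of `JmInterchange`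
    verbatim (`jmInterchange_iff_pointwise` is `Iff.rfl`).  `ZeroExcessPairOrder U δ` (ZEPO): eventually
    in even `L` some unit vector of sector `N_L` or `N_L - 2` (`S^z = 0`) lies within `εL²` of its sector
    floor and has `d`-wave pair intensity `≥ cL⁴`.
§2  THE FORWARD HALF `HypGivesZEPO` is cut into two abstract finite-dimensional lemmas and one
    instantiation:
    * `WindowPigeonhole` — column pigeonhole on a Hermitian window matrix `W` (no spectral theorem:
      `⟨ψ_W, (A ⊗ 1 + 1 ⊗ Aᵀ) ψ_W⟩ = 2 Σ_t ⟨w_t, A w_t⟩` over the columns `w_t` of `W`, and the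
      Hilbert–Schmidt Cauchy–Schwarz `Re Tr(W D W Dᴴ) ≤ ‖Dᴴ W‖_HS ‖W Dᴴ‖_HS ≤ √M · (Σ_t ‖D w_t‖²)^{1/2}`);
    * `CouplingExpectBound` — `Re⟨ψ, K ψ⟩ ≤ 2M‖ψ‖²` for `K = D ⊗ D̄ + Dᴴ ⊗ D̄ᴴ` from the one-layer
      bounds `‖D v‖², ‖Dᴴ v‖² ≤ M‖v‖²`;
    * `stub_hypGivesZEPO_of` — instantiation on the Josephson window double (PSD minimiser
      `jmPositiveMinimiser_proof`, Feynman–Hellmann `sub_le_of_isMinimiser`, `norm_pairField_le`,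
      `block_rayleigh_lower`, sector ground states `szSector_groundState`).
§3  RESIDUES (c0).  `ZeroExcessOrderReachesFloor` (KT core; the one stub carrying the crux's `∀ (U, δ)`
    exposure; held by the lead), `SymmetricWindowInputs` (model inputs at an admissible scale `γ_L`),
    `BridgeFromFloorOrder` (floor order ⇒ adjacent-floor bridge by the tree's two-sided pair-transfer
    rung `Theorems.stub_pairTransferRung` + spectral Markov in sector `N_L - 2`), and the composition.
§5  (lead c2) THE INTERCHANGE IN RATE FORM — CLOSED in the tree (`Theorems.JosephsonMirror.rateFormInterchange`,
    p129634; engine p128581, tools p128882, floor data p129458): two-sector isolation `γ_L` + Josephson gain at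
    couplings `J_L` with `J_L L² / γ_L → 0` ⇒ `FloorBridge` (`a' = a/4`).  It does NOT imply the filed (fixed-`J`,
    energy-density) crux, which stays `↔ (R1 ∧ R2')`; it is the line's positive residue and the planner's restatement (B').
§6  (lead c3) TWO MORE TREE FACTS, no change of stubs (the line is at the crux's fixed point; wave: none — both open
    stubs are open-problem grade):
    * `Theorems.JosephsonMirror.jmInterchange_iff_onsetUpgrade` (p137538, with `floorBridge_of_uniformGain`,
      `uniformGain_of_floorBridge`, `exists_twoFloorIsolation`): the crux is EXACTLY the onset upgrade "pointwise-onset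
      linear gain ⇒ uniform-onset linear gain" at every `(U, δ, a, J₀)` — the interchange of `∀ J ∃ L₀` and `∃ L₀ ∀ J`,
      i.e. of `lim_{J↓0}` and `liminf_L`, and nothing else (re-exported below as `jmInterchange_iff_onsetUpgrade'`);
    * `JmInterchangeNegative.JmInterchange_false_of_ZepoFloorMismatch` (p137666, negative lemma modulo H, Theorems/
      JmInterchange/Negative/): zero-excess pair order at a point whose adjacent floors `G(N_L,0)`, `G(N_L-2,0)` are
      space-group isotypic with mismatched characters for infinitely many even `L` refutes the crux (the route's kill
      criterion (a), typed; H not constructible today).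
§7  (lead c4) THE LINE'S RESIDUES ARE NOT ABSTRACT — two kernel-checked counter-models in the crux's exact `let` vocabulary
    (Theorems/JmInterchange/Negative/, `--supports stmt-2227`; no change of stubs, wave: none):
    * `JmInterchangeNegative.not_abstractWindowInterchange` (p139180, `AbstractWindowInterchangeFalse.lean`; profile facts p139501,
      `AbstractWindowInterchangeProfile.lean`): the (R1)-shape — layer `ℂ⁴`, `A = diag(0,1,0,1)`, `Δ_L = L²|e₃⟩⟨e₁|`: Hermitian
      block-diagonal `A`, balanced SIMPLE floors isolated by gap `1`, lowering `Δ_L` with `‖Δ_L v‖² ≤ L⁴‖v‖²`, the crux's gain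
      hypothesis with `a = 1/2` for EVERY `J > 0` (onset `⌈4/J⌉`, no gain for `J L² ≤ 2`: profile `max(0, J L² − 2)`), zero-excess
      order carried by the excited branch, floor bridge ≡ 0 (Δ_L kills the floor);
    * `JmInterchangeNegative.not_abstractFloorOrderBridges` (p139490, `AbstractFloorOrderBridgeFalse.lean`): the (R2′)-shape —
      layer `ℂ³`, `A_L = diag(0,0,L⁻²)`, `Δ_L = L²|e₂⟩⟨e₀|`: FLOOR ORDER `L⁴`, the Koma–Tasaki locality budget (excess of the pair
      image `≤ L²‖g‖²`, the model input of `bridgeFromFloorOrder`), balanced floors, the crux's gain, and bridge ≡ 0 — the pair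
      image of the floor sits at the excited level `L⁻²` of the adjacent block (tower collision at the KT scale).
    So every structure the route's tools see (Hermiticity, charge blocks, `μ_L` balancing, Kronecker/RP packaging, two-sided
    Feynman–Hellmann, norm and locality budgets, fixed-scale isolation) is provably insufficient for either stub; a supplier must
    bring floor-level spectral information about `hubbardTorus 2 L 1 U` at every doped `(U, δ)`.
§8  (lead c5) THE COUPLING RANGE `J₀` IS IDLE (p141101, `Theorems.JosephsonMirror.jmInterchange_iff_unitRange`, with
    `gain_mono_coupling` / `gainHyp_mono_range`; no change of stubs, wave: none): by concavity of `E_L` the secant slope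
    `(E_L(0) − E_L(J))/J` is non-decreasing in `J`, so `GainHyp U δ a J₀ → GainHyp U δ a J₀'` for every `J₀' > 0` with the SAME `a`,
    and `JmInterchange ↔` its instance `J₀ = 1` (re-exported below as `jmInterchange_iff_unitRange'`).  c5 also audited the formal
    statement for definitional loopholes (`Matrix.minEnergyOn` = `sInf` over unit vectors, junk only at `⊥`; `IsGroundStateInSector`;
    `szSector`; the window predicate; the Kronecker packaging): none — hypothesis and conclusion are eventually-in-`L` statements about
    genuine minima and genuine sector ground states, so the item is faithful and its truth value is exactly (R1 ∧ R2′).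
-/

set_option linter.dupNamespace false

namespace Summit.HubbardSuperconductivity.HubbardSuperconductivity.Cruxes.JmInterchange.Sketch

open Literature.MathematicalPhysics.QuantumLattice Filter
open scoped Matrix Kronecker
open Summit.HubbardSuperconductivity.HubbardSuperconductivity.Theses.JosephsonMirror (JmInterchange)

noncomputable section

/-- The summit's particle number `N_L = 2⌊(1-δ)L²/2⌋`. -/
def statN (δ : ℝ) (L : ℕ) : ℕ := 2 * ⌊(1 - δ) * (L : ℝ) ^ 2 / 2⌋₊

/-! ## §1 Normal form -/

/-- The HYPOTHESIS of `JmInterchange` at `(U, δ, a, J₀)`, verbatim. -/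
def GainHyp (U δ a J₀ : ℝ) : Prop :=
  ∀ J ∈ Set.Ioc (0:ℝ) J₀, ∃ L₀ : ℕ, ∀ (L : ℕ) [NeZero L], Even L → L₀ ≤ L → (let ι : Type := Finset (Literature.MathematicalPhysics.QuantumLattice.Orb (Literature.MathematicalPhysics.QuantumLattice.FermionTorus 2 L)); let N : ℕ := 2 * ⌊(1 - δ) * (L : ℝ) ^ 2 / 2⌋₊; let H : Matrix ι ι ℂ := Literature.MathematicalPhysics.QuantumLattice.hubbardTorus 2 L 1 U; let μ : ℝ := (H.minEnergyOn (Literature.MathematicalPhysics.QuantumLattice.szSector N 0) - H.minEnergyOn (Literature.MathematicalPhysics.QuantumLattice.szSector (N - 2) 0)) / 2; let A : Matrix ι ι ℂ := Literature.MathematicalPhysics.QuantumLattice.hubbardTorusWith 2 L 1 U μ; let D : Matrix ι ι ℂ := ((L : ℂ))⁻¹ • Literature.MathematicalPhysics.QuantumLattice.pairField Literature.MathematicalPhysics.QuantumLattice.dWaveFormFactor L; let Hd : ℝ → Matrix (ι × ι) (ι × ι) ℂ := fun J => Matrix.kroneckerMap (fun a b : ℂ => a * b) A 1 + Matrix.kroneckerMap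 (fun a b : ℂ => a * b) 1 (Matrix.transpose A) - (J : ℂ) • (Matrix.kroneckerMap (fun a b : ℂ => a * b) D (Matrix.transpose (Matrix.conjTranspose D)) + Matrix.kroneckerMap (fun a b : ℂ => a * b) (Matrix.conjTranspose D) (Matrix.transpose D)); let good : ι × ι → Prop := fun p => ((p.1.card = N ∧ p.2.card = N) ∨ (p.1.card = N - 2 ∧ p.2.card = N - 2)) ∧ (p.1.filter (fun o => (ofLex o).2 = 0)).card = (p.1.filter (fun o => (ofLex o).2 = 1)).card ∧ (p.2.filter (fun o => (ofLex o).2 = 0)).card = (p.2.filter (fun o => (ofLex o).2 = 1)).card; let S : Submodule ℂ (ι × ι → ℂ) := ⨅ (p : ι × ι) (_ : ¬ good p), LinearMap.ker (LinearMap.proj (R := ℂ) (φ := fun _ : ι × ι => ℂ) p); let E : ℝ → ℝ := fun J => (Hd J).minEnergyOn S; a * J * (L : ℝ) ^ 2 ≤ E 0 - E J)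

/-- The CONCLUSION of `JmInterchange` at `(U, δ)`, verbatim. -/
def FloorBridge (U δ : ℝ) : Prop :=
  ∃ a' : ℝ, 0 < a' ∧ ∃ L₀ : ℕ, ∀ (L : ℕ) [NeZero L], Even L → L₀ ≤ L → ∃ φ χ : Literature.MathematicalPhysics.QuantumLattice.Fock (Literature.MathematicalPhysics.QuantumLattice.Orb (Literature.MathematicalPhysics.QuantumLattice.FermionTorus 2 L)), Literature.MathematicalPhysics.QuantumLattice.IsGroundStateInSector (Literature.MathematicalPhysics.QuantumLattice.hubbardTorus 2 L 1 U) (2 * ⌊(1 - δ) * (L : ℝ) ^ 2 / 2⌋₊) 0 φ ∧ star φ ⬝ᵥ φ = 1 ∧ Literature.MathematicalPhysics.QuantumLattice.IsGroundStateInSector (Literature.MathematicalPhysics.QuantumLattice.hubbardTorus 2 L 1 U) (2 * ⌊(1 - δ) * (L : ℝ) ^ 2 / 2⌋₊ - 2) 0 χ ∧ star χ ⬝ᵥ χ = 1 ∧ a' * (L : ℝ) ^ 4 ≤ ‖star χ ⬝ᵥ Matrix.mulVec (Literature.MathematicalPhysics.QuantumLattice.pairField Literature.MathematicalPhysics.QuantumLattice.dWaveFormFactor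 L) φ‖ ^ 2

/-- The crux IS `∀ (U, δ, a, J₀), GainHyp → FloorBridge` (definitional). -/
theorem jmInterchange_iff_pointwise :
    JmInterchange ↔ ∀ (U δ a J₀ : ℝ), 0 < U → δ ∈ Set.Ioo (0:ℝ) (1 / 2) → 0 < a → 0 < J₀ →
      GainHyp U δ a J₀ → FloorBridge U δ :=
  Iff.rfl

/-- ZERO-EXCESS PAIR ORDER at `(U, δ)`: some `c > 0` such that for every `ε > 0`, eventually in even
`L`, a unit vector `v` of sector `N_L` or `N_L - 2` (`S^z = 0`) has energy `≤ e_L(n) + εL²` and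
`‖Δ_d v‖² ≥ cL⁴`. -/
def ZeroExcessPairOrder (U δ : ℝ) : Prop :=
  ∃ c : ℝ, 0 < c ∧ ∀ ε : ℝ, 0 < ε → ∃ L₀ : ℕ, ∀ (L : ℕ) [NeZero L], Even L → L₀ ≤ L →
    ∃ n : ℕ, (n = statN δ L ∨ n = statN δ L - 2) ∧
      ∃ v : Fock (Orb (FermionTorus 2 L)), v ∈ szSector n 0 ∧ star v ⬝ᵥ v = 1 ∧
        (star v ⬝ᵥ (hubbardTorus 2 L 1 U *ᵥ v)).re ≤
            (hubbardTorus 2 L 1 U).minEnergyOn (szSector n 0) + ε * (L : ℝ) ^ 2 ∧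
        c * (L : ℝ) ^ 4 ≤
          (star (pairField dWaveFormFactor L *ᵥ v) ⬝ᵥ (pairField dWaveFormFactor L *ᵥ v)).re

/-- FORWARD HALF: gain ⇒ zero-excess pair order. -/
def HypGivesZEPO : Prop :=
  ∀ (U δ a J₀ : ℝ), 0 < U → δ ∈ Set.Ioo (0:ℝ) (1 / 2) → 0 < a → 0 < J₀ →
    GainHyp U δ a J₀ → ZeroExcessPairOrder U δ

/-! ## §2 The forward half, cut into two abstract lemmas and an instantiation -/

/-- ABSTRACT COLUMN PIGEONHOLE on a Hermitian window matrix.  `A` Hermitian, `D` arbitrary on a finite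
index type; two disjoint blocks `P₁, P₂`; `W = Wᴴ` supported on pairs in a common block
(`¬ good (s,t) → W s t = 0`, `good (s,t) → same block`), packaged as the two-layer unit vector
`ψ_W (s,t) = W s t`; `A ≥ e₀` on block-supported vectors; one-layer bounds `‖D v‖², ‖Dᴴ v‖² ≤ M ‖v‖²`.
If `Re⟨ψ_W, (A ⊗ 1 + 1 ⊗ Aᵀ) ψ_W⟩ ≤ 2e₀ + η` and `κ ≤ Re⟨ψ_W, (D ⊗ D̄ + Dᴴ ⊗ D̄ᴴ) ψ_W⟩`
(`D̄ = Dᴴᵀ`), then some normalised block-supported vector `v` (a column of `W`) has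
`Re⟨v, A v⟩ ≤ e₀ + 8M²η/κ²` and `‖D v‖² ≥ κ²/(8M)`.
Proof sketch: columns `w_t := W·e_t` are block-supported, `Σ_t ‖w_t‖² = 1`,
`⟨ψ,(A⊗1)ψ⟩ = Σ_t ⟨w_t, A w_t⟩ = ⟨ψ,(1⊗Aᵀ)ψ⟩` (Hermitian `W`, `A`), so `Σ_t (⟨w_t,Aw_t⟩ - e₀‖w_t‖²) ≤ η/2`;
`⟨ψ,(D⊗D̄)ψ⟩ = Tr(Wᴴ D W Dᴴ) = ⟨DᴴW, WDᴴ⟩_HS ≤ ‖DᴴW‖_HS ‖WDᴴ‖_HS ≤ √M (Σ_t ‖D w_t‖²)^{1/2}` and the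
same for the second coupling term, so `Σ_t ‖D w_t‖² ≥ κ²/(4M)`; reverse Markov (`‖Dw_t‖² ≤ M‖w_t‖²`)
and Markov on the excesses give a column with both properties. [folklore] -/
def WindowPigeonhole : Prop :=
  ∀ {ι : Type} [Fintype ι] [DecidableEq ι] (A D W : Matrix ι ι ℂ) (P₁ P₂ : ι → Prop)
    (good : ι × ι → Prop) (e₀ M η κ : ℝ),
    A.IsHermitian → Wᴴ = W → (∀ s, P₁ s → ¬ P₂ s) →
    (∀ s t, good (s, t) → (P₁ s ∧ P₁ t) ∨ (P₂ s ∧ P₂ t)) →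
    (∀ s t, ¬ good (s, t) → W s t = 0) →
    0 < M → 0 ≤ η → 0 < κ →
    (∀ v : ι → ℂ, (∀ s, ¬ P₁ s → v s = 0) → e₀ * (star v ⬝ᵥ v).re ≤ (star v ⬝ᵥ A *ᵥ v).re) →
    (∀ v : ι → ℂ, (∀ s, ¬ P₂ s → v s = 0) → e₀ * (star v ⬝ᵥ v).re ≤ (star v ⬝ᵥ A *ᵥ v).re) →
    (∀ v : ι → ℂ, (star (D *ᵥ v) ⬝ᵥ (D *ᵥ v)).re ≤ M * (star v ⬝ᵥ v).re) →
    (∀ v : ι → ℂ, (star (Dᴴ *ᵥ v) ⬝ᵥ (Dᴴ *ᵥ v)).re ≤ M * (star v ⬝ᵥ v).re) →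
    star (fun p : ι × ι => W p.1 p.2) ⬝ᵥ (fun p : ι × ι => W p.1 p.2) = 1 →
    (star (fun p : ι × ι => W p.1 p.2) ⬝ᵥ
        (A ⊗ₖ (1 : Matrix ι ι ℂ) + (1 : Matrix ι ι ℂ) ⊗ₖ Aᵀ) *ᵥ (fun p : ι × ι => W p.1 p.2)).re ≤
      2 * e₀ + η →
    κ ≤ (star (fun p : ι × ι => W p.1 p.2) ⬝ᵥ
        (D ⊗ₖ Dᴴᵀ + Dᴴ ⊗ₖ Dᵀ) *ᵥ (fun p : ι × ι => W p.1 p.2)).re →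
    ∃ v : ι → ℂ, ((∀ s, ¬ P₁ s → v s = 0) ∨ (∀ s, ¬ P₂ s → v s = 0)) ∧ star v ⬝ᵥ v = 1 ∧
      (star v ⬝ᵥ A *ᵥ v).re ≤ e₀ + 8 * M ^ 2 * η / κ ^ 2 ∧
      κ ^ 2 / (8 * M) ≤ (star (D *ᵥ v) ⬝ᵥ (D *ᵥ v)).re

/-- ABSTRACT COUPLING BOUND: `Re⟨ψ, (D ⊗ D̄ + Dᴴ ⊗ D̄ᴴ) ψ⟩ ≤ 2M ‖ψ‖²` for every two-layer vector `ψ`,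
from the one-layer bounds `‖D v‖², ‖Dᴴ v‖² ≤ M‖v‖²` (`⟨ψ_W,(D⊗D̄)ψ_W⟩ = Tr(WᴴDWDᴴ) ≤ ‖DᴴW‖_HS‖WDᴴ‖_HS`,
columns for the first factor, conjugated rows for the second). [folklore] -/
def CouplingExpectBound : Prop :=
  ∀ {ι : Type} [Fintype ι] [DecidableEq ι] (D : Matrix ι ι ℂ) (M : ℝ) (ψ : ι × ι → ℂ),
    0 ≤ M →
    (∀ v : ι → ℂ, (star (D *ᵥ v) ⬝ᵥ (D *ᵥ v)).re ≤ M * (star v ⬝ᵥ v).re) →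
    (∀ v : ι → ℂ, (star (Dᴴ *ᵥ v) ⬝ᵥ (Dᴴ *ᵥ v)).re ≤ M * (star v ⬝ᵥ v).re) →
    (star ψ ⬝ᵥ (D ⊗ₖ Dᴴᵀ + Dᴴ ⊗ₖ Dᵀ) *ᵥ ψ).re ≤ 2 * M * (star ψ ⬝ᵥ ψ).re

/-- stub (CLOSED, p102503): the abstract column pigeonhole — tree theorem
`Theorems.JosephsonMirror.windowPigeonhole` (Theorems/JosephsonMirrorJmInterchangeWindowPigeonhole.lean). -/
theorem stub_windowPigeonhole : WindowPigeonhole := by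
  intro ι _ _
  exact Summit.HubbardSuperconductivity.HubbardSuperconductivity.Theorems.JosephsonMirror.windowPigeonhole

/-- stub (CLOSED, p103892): the abstract coupling bound — tree theorem
`Theorems.JosephsonMirror.couplingExpectBound` (Theorems/JosephsonMirrorJmInterchangeCouplingBound.lean). -/
theorem stub_couplingExpectBound : CouplingExpectBound := by
  intro ι _ _
  exact Summit.HubbardSuperconductivity.HubbardSuperconductivity.Theorems.JosephsonMirror.couplingExpectBound

/-- stub (CLOSED, p106153; tree theorem `Theorems.JosephsonMirror.hypGivesZEPO_of_pigeonhole`,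
Theorems/JosephsonMirrorJmInterchangeHypGivesZEPO.lean): INSTANTIATION — the two abstract lemmas give the forward half on the Josephson window double.
For `ε > 0` pick `J := min J₀ (ε a² / (16 C⁶))` (`C L²` the `norm_pairField_le` bound, `M = C²L²` for
`D = L⁻¹Δ_d`), then `L ≥ L₀(J)`: the PSD minimiser `ψ_W` of `jmPositiveMinimiser_proof` has
`Re⟨ψ,Kψ⟩ ≥ aL² =: κ` (`sub_le_of_isMinimiser` and the gain `aJL² ≤ E(0) - E(J)`), and
`Re⟨ψ,H₀ψ⟩ = E(J) + J Re⟨ψ,Kψ⟩ ≤ E(0) + 2JM ≤ 2e₀ + 2JM` (`re_rayleigh_windowDouble`,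
`CouplingExpectBound`, trial state `φ ⊗ φ̄` of a sector-`N_L` ground state `φ` for `E(0) ≤ 2e₀`,
`e₀ = e(N_L) - μ_L N_L = e(N_L-2) - μ_L (N_L-2)`); `A ≥ e₀` on both blocks is `block_rayleigh_lower`;
the column `v` of `WindowPigeonhole` lies in `szSector n 0` (`mem_szSector_two_mul_zero_iff`,
`block_iff`) with `Re⟨v,Hv⟩ - e(n) = Re⟨v,Av⟩ - e₀ ≤ 16 C⁶ J L²/a² ≤ εL²` and
`‖Δ_d v‖² = L²‖Dv‖² ≥ a²L⁴/(8C²)`. -/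
theorem stub_hypGivesZEPO_of : WindowPigeonhole → CouplingExpectBound → HypGivesZEPO := by
  intro hP hC
  exact Summit.HubbardSuperconductivity.HubbardSuperconductivity.Theorems.JosephsonMirror.hypGivesZEPO_of_pigeonhole
    hP hC

/-! ## §3 Residues and the bridge engine -/

/-- GROUND-FLOOR ORDER at `(U, δ)`: eventually in even `L` SOME unit ground state of `(N_L, S^z = 0)` has
`‖Δ_d g‖² ≥ cL⁴`. -/
def FloorOrder (U δ : ℝ) : Prop :=
  ∃ c : ℝ, 0 < c ∧ ∃ L₀ : ℕ, ∀ (L : ℕ) [NeZero L], Even L → L₀ ≤ L →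
    ∃ g : Fock (Orb (FermionTorus 2 L)), IsGroundStateInSector (hubbardTorus 2 L 1 U) (statN δ L) 0 g ∧
      star g ⬝ᵥ g = 1 ∧
      c * (L : ℝ) ^ 4 ≤
        (star (pairField dWaveFormFactor L *ᵥ g) ⬝ᵥ (pairField dWaveFormFactor L *ᵥ g)).re

/-- THE EXPOSED STUB (Koma–Tasaki core): zero-excess pair order reaches the ground floor. -/
def ZeroExcessOrderReachesFloor : Prop :=
  ∀ (U δ : ℝ), 0 < U → δ ∈ Set.Ioo (0:ℝ) (1 / 2) → ZeroExcessPairOrder U δ → FloorOrder U δ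

/-- BRIDGE INPUT 1 (scale `γ_L`): the low-lying window `(e(N_L-2), e(N_L-2) + γ_L)` of sector
`(N_L - 2, 0)` is orthogonal to `Δ_d G(N_L)`. -/
def LowLyingOrthogonality (U δ : ℝ) (γ : ℕ → ℝ) : Prop :=
  ∃ L₀ : ℕ, ∀ (L : ℕ) [NeZero L], Even L → L₀ ≤ L →
    ∀ g : Fock (Orb (FermionTorus 2 L)), IsGroundStateInSector (hubbardTorus 2 L 1 U) (statN δ L) 0 g →
      ∀ (w : Fock (Orb (FermionTorus 2 L))) (E : ℝ), w ∈ szSector (statN δ L - 2) 0 →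
        hubbardTorus 2 L 1 U *ᵥ w = (E : ℂ) • w →
        (hubbardTorus 2 L 1 U).minEnergyOn (szSector (statN δ L - 2) 0) < E →
        E < (hubbardTorus 2 L 1 U).minEnergyOn (szSector (statN δ L - 2) 0) + γ L →
          star w ⬝ᵥ (pairField dWaveFormFactor L *ᵥ g) = 0

/-- BRIDGE INPUT 2 (scale `γ_L`): no pair-binding concavity of the even-sector floor energies at `N_L`
beyond `o(γ_L)`: `2e(N_L) - e(N_L+2) - e(N_L-2) ≤ εγ_L` eventually. -/
def ChargingFloor (U δ : ℝ) (γ : ℕ → ℝ) : Prop :=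
  ∀ ε : ℝ, 0 < ε → ∃ L₀ : ℕ, ∀ (L : ℕ), Even L → L₀ ≤ L →
    (let e : ℕ → ℝ := fun n => (hubbardTorus 2 L 1 U).minEnergyOn (szSector n 0)
     let N : ℕ := statN δ L
     2 * e N - e (N + 2) - e (N - 2) ≤ ε * γ L)

/-- THE ENGINE: floor order ⇒ adjacent-floor bridge, given the two inputs at a scale `γ_L` with
`γ_L L² → ∞`.  For the unit floor state `g` of `FloorOrder` (`‖Δg‖² ≥ cL⁴`, `Δ = Δ_d`): the tree's
two-sided rung `Summit.HubbardSuperconductivity.HubbardSuperconductivity.Theorems.stub_pairTransferRung`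
(at `m = N_L - 2`, `a := δ/2`, large `L`) gives
`exc := Re⟨Δg, HΔg⟩ - e(N_L-2)‖Δg‖² ≤ CL² + max(0, 2e(N_L) - e(N_L-2) - e(N_L+2)) ‖Δg‖²`
(drop the nonnegative `N_L + 2` summand by the sector variational principle), hence `≤ CL² + εγ_L‖Δg‖²`
(`ChargingFloor`); in sector `(N_L-2, 0)` (invariant under the Hermitian `H`) split `Δg = u₀ + u'`,
`u₀ :=` component in the ground eigenspace; by `LowLyingOrthogonality` `u'` has no component on
eigenvalues in `(e, e+γ_L)`, so `exc = Re⟨u',(H-e)u'⟩ ≥ γ_L‖u'‖²`, `‖u₀‖² ≥ ‖Δg‖² - exc/γ_L ≥ ‖Δg‖²/2`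
for large `L` (`γ_L L² → ∞`, `ε = 1/4`); `χ := u₀/‖u₀‖` is a sector ground state with
`|⟨χ, Δg⟩|² = ‖u₀‖² ≥ (c/2)L⁴`. -/
def BridgeFromFloorOrder : Prop :=
  ∀ (U δ : ℝ), 0 < U → δ ∈ Set.Ioo (0:ℝ) (1 / 2) → ∀ γ : ℕ → ℝ,
    Tendsto (fun L : ℕ => γ L * (L : ℝ) ^ 2) atTop atTop →
    LowLyingOrthogonality U δ γ → ChargingFloor U δ γ → FloorOrder U δ → FloorBridge U δ

/-- The bridge inputs at SOME admissible scale `γ_L` with `γ_L L² → ∞`. -/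
def SymmetricWindowInputs : Prop :=
  ∀ (U δ : ℝ), 0 < U → δ ∈ Set.Ioo (0:ℝ) (1 / 2) → FloorOrder U δ →
    ∃ γ : ℕ → ℝ, Tendsto (fun L : ℕ => γ L * (L : ℝ) ^ 2) atTop atTop ∧
      LowLyingOrthogonality U δ γ ∧ ChargingFloor U δ γ

/-- stub (lead; R1): the exposed Koma–Tasaki core — zero-excess pair order reaches the floor, at EVERY `(U, δ)`.
Registered Theorems-level form: `floorOrder_of_zeroExcessPairOrder` (spelled out).  NECESSARY for the crux (p126771).
Status (leads c0, c1): no supplier exists in the tree, the route or the literature — it is the Lieb–Seiringer–Yngvason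
(Rep. Math. Phys. 59 (2007) 389, p. 9) / Tasaki (J. Stat. Phys. 174 (2019) 735, §5) OPEN CONVERSE "order at vanishing
excess energy density ⇒ order on the ground floor" for the `d`-wave pair order parameter of the doped 2D Hubbard torus,
universally in `(U, δ)`; it is FALSE for general local Hamiltonians (two phases of equal energy density, the disordered
one winning the floor by a sub-extensive margin — the retriage shape `g_L(J) = 2a·max(0, J − 1/L)` is its
one-dimensional shadow), so only Hubbard-specific input could prove it, and the universally quantified form is hostage to
isolated equal-density-equal-chemical-potential coexistence points `(U*, δ*)` (e.g. a `d_{x²-y²}`/`d_{xy}`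
pairing-symmetry boundary inside `δ ∈ (0, 1/2)`), which no current method can exclude or exhibit. -/
theorem stub_zepoReachesFloor : ZeroExcessOrderReachesFloor := by
  sorry

/-- CLOSED former stub (p107506): the engine with EXACT low-lying orthogonality — tree theorem
`Theorems.JosephsonMirror.bridgeFromFloorOrder` (Theorems/JosephsonMirrorJmInterchangeBridge.lean: rung
`Theorems.stub_pairTransferRung` + spectral Markov `spectralMarkov_of_window_orthogonal`).  Superseded in the
composition by the approximate version `stub_bridgeFromFloorOrderApprox` (reshape, cycle 1), kept as the exact case. -/
theorem bridgeFromFloorOrder_exact : BridgeFromFloorOrder := by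
  exact Summit.HubbardSuperconductivity.HubbardSuperconductivity.Theorems.JosephsonMirror.bridgeFromFloorOrder

/-! ## §3b Reshape (cycle 1): APPROXIMATE low-lying orthogonality suffices -/

/-- APPROXIMATE BRIDGE INPUT 1 (scale `γ_L`, leakage `1/4`): for every ground state `g` of `(N_L, 0)`, the
spectral weight of `u := Δ_d g` carried by eigenvalues of `H` in the open window `(e, e + γ_L)`,
`e = e(N_L - 2)`, is at most `‖u‖²/4`.  Written with the spectral projection
`Q = U · diag 𝟙[e < λ_i < e + γ_L] · U⋆` of the eigenbasis `U = hH.eigenvectorUnitary` of `H` (any proof `hH`;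
`Q` does not depend on the choice); since `u ∈ szSector (N_L - 2) 0 =: K` and `K` is `H`-invariant, `‖Q u‖²` is the
weight of `u` on the window eigenvectors INSIDE `K`.  Exact orthogonality (`LowLyingOrthogonality`) is the case
`Q u = 0`. -/
def ApproxLowLyingOrthogonality (U δ : ℝ) (γ : ℕ → ℝ) : Prop :=
  ∃ L₀ : ℕ, ∀ (L : ℕ) [NeZero L], Even L → L₀ ≤ L →
    ∀ g : Fock (Orb (FermionTorus 2 L)), IsGroundStateInSector (hubbardTorus 2 L 1 U) (statN δ L) 0 g →
      (let H : Matrix (Finset (Orb (FermionTorus 2 L))) (Finset (Orb (FermionTorus 2 L))) ℂ :=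
         hubbardTorus 2 L 1 U
       let hH : H.IsHermitian := LiebThm1.hamiltonian_isHermitian (fermionTorusGraph 2 L) 1 U
       let e : ℝ := H.minEnergyOn (szSector (statN δ L - 2) 0)
       let Q : Matrix (Finset (Orb (FermionTorus 2 L))) (Finset (Orb (FermionTorus 2 L))) ℂ :=
         (hH.eigenvectorUnitary : Matrix (Finset (Orb (FermionTorus 2 L))) (Finset (Orb (FermionTorus 2 L))) ℂ) *
           Matrix.diagonal (fun i => if e < hH.eigenvalues i ∧ hH.eigenvalues i < e + γ L then (1 : ℂ) else 0) *
             star (hH.eigenvectorUnitary :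
               Matrix (Finset (Orb (FermionTorus 2 L))) (Finset (Orb (FermionTorus 2 L))) ℂ)
       let u : Fock (Orb (FermionTorus 2 L)) := pairField dWaveFormFactor L *ᵥ g
       (star (Q *ᵥ u) ⬝ᵥ (Q *ᵥ u)).re ≤ (1 / 4) * (star u ⬝ᵥ u).re)

/-- THE ENGINE, approximate form: floor order ⇒ adjacent-floor bridge from APPROXIMATE low-lying orthogonality
and the charging floor at a scale `γ_L` with `γ_L L² → ∞`.  Same proof as `bridgeFromFloorOrder` with the window
components bounded by `‖u‖²/4` instead of `0`: `exc ≥ γ_L (‖u‖² − ‖u₀‖² − ‖Qu‖²)`, so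
`‖u₀‖² ≥ (3/4)‖u‖² − exc/γ_L ≥ ‖u‖²/4` eventually (`exc ≤ CL² + (γ_L/4)‖u‖²`), `a' = c/4`. -/
def BridgeFromFloorOrderApprox : Prop :=
  ∀ (U δ : ℝ), 0 < U → δ ∈ Set.Ioo (0:ℝ) (1 / 2) → ∀ γ : ℕ → ℝ,
    Tendsto (fun L : ℕ => γ L * (L : ℝ) ^ 2) atTop atTop →
    ApproxLowLyingOrthogonality U δ γ → ChargingFloor U δ γ → FloorOrder U δ → FloorBridge U δ

/-- The approximate bridge inputs at SOME admissible scale `γ_L` with `γ_L L² → ∞`. -/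
def SymmetricWindowInputsApprox : Prop :=
  ∀ (U δ : ℝ), 0 < U → δ ∈ Set.Ioo (0:ℝ) (1 / 2) → FloorOrder U δ →
    ∃ γ : ℕ → ℝ, Tendsto (fun L : ℕ => γ L * (L : ℝ) ^ 2) atTop atTop ∧
      ApproxLowLyingOrthogonality U δ γ ∧ ChargingFloor U δ γ

/-- stub (CLOSED, p110900): the approximate engine — tree theorem
`Theorems.JosephsonMirror.bridgeFromFloorOrderApprox` (Theorems/JosephsonMirrorJmInterchangeBridgeApprox.lean,
`spectralMarkov_of_window_weight`; a' = c/4). -/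
theorem stub_bridgeFromFloorOrderApprox : BridgeFromFloorOrderApprox := by
  exact Summit.HubbardSuperconductivity.HubbardSuperconductivity.Theorems.JosephsonMirror.bridgeFromFloorOrderApprox

/-! ## §3c The converse half of the normal form (the mirror is eliminable) -/

/-- BACKWARD HALF: zero-excess pair order ⇒ gain, via the window trial pair `(v, Δ_d v/‖Δ_d v‖)` (or
`(Δ_dᴴ v/‖Δ_dᴴ v‖, v)` when `v` sits in `N_L - 2`) and the tree's trial-pair bound
`Theorems.JosephsonMirror.trialPair_gain_le_minEnergyOn_sub`; the partner's excess is `≤ ε'L² + O(1)` by the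
Koma–Tasaki commutator bookkeeping. -/
def ZEPOGivesHyp : Prop :=
  ∀ (U δ : ℝ), 0 < U → δ ∈ Set.Ioo (0:ℝ) (1 / 2) → ZeroExcessPairOrder U δ →
    ∃ a J₀ : ℝ, 0 < a ∧ 0 < J₀ ∧ GainHyp U δ a J₀

/-- The SINGLE-LAYER FORM of the crux: zero-excess pair order ⇒ ground-floor pair bridge, at every `(U, δ)`. -/
def SingleLayerForm : Prop :=
  ∀ (U δ : ℝ), 0 < U → δ ∈ Set.Ioo (0:ℝ) (1 / 2) → ZeroExcessPairOrder U δ → FloorBridge U δ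

/-- stub (CLOSED, p110212 with aux p109955): the converse half — tree theorem
`Theorems.JosephsonMirror.zepoGivesHyp` (Theorems/JosephsonMirrorJmInterchangeZepoGivesHyp{,Aux}.lean; trial pair
`(v, Δv/‖Δv‖)` resp. `(Δᴴv/‖Δᴴv‖, v)` in `trialPair_gain_le_minEnergyOn_sub`; a = c/4, J₀ = 1). -/
theorem stub_zepoGivesHyp : ZEPOGivesHyp := by
  exact Summit.HubbardSuperconductivity.HubbardSuperconductivity.Theorems.JosephsonMirror.zepoGivesHyp

/-- NORMAL FORM (logic, given the two halves): the mirror is eliminable — `JmInterchange ↔ SingleLayerForm`. -/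
theorem jmInterchange_iff_singleLayer (h₁ : HypGivesZEPO) (h₂ : ZEPOGivesHyp) :
    JmInterchange ↔ SingleLayerForm := by
  rw [jmInterchange_iff_pointwise]
  constructor
  · intro h U δ hU hδ hZ
    obtain ⟨a, J₀, ha, hJ₀, hG⟩ := h₂ U δ hU hδ hZ
    exact h U δ a J₀ hU hδ ha hJ₀ hG
  · intro h U δ a J₀ hU hδ ha hJ₀ hG
    exact h U δ hU hδ (h₁ U δ a J₀ hU hδ ha hJ₀ hG)

/-- The normal form, modulo the registered stubs: `JmInterchange ↔ SingleLayerForm`. -/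
theorem JmInterchange_iff_singleLayerForm : JmInterchange ↔ SingleLayerForm :=
  jmInterchange_iff_singleLayer (stub_hypGivesZEPO_of stub_windowPigeonhole stub_couplingExpectBound)
    stub_zepoGivesHyp

/-! ## §3d Reshape (lead c1, cycle 1): the EXACT two-residue normal form

Both residues below are single-layer statements about `hubbardTorus 2 L 1 U` alone and BOTH ARE NECESSARY for the
crux (`zepoReachesFloor_of_jmInterchange`, `floorOrderBridges_of_jmInterchange`); together they are sufficient
(`jmInterchange_of_reachesFloor_of_bridges`).  So `JmInterchange ↔ (R1 ∧ R2')` (`jmInterchange_iff_residues`): the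
line has no slack left — whatever closes the crux closes exactly these two stubs, and conversely. -/

/-- (R2') FLOOR ORDER BRIDGES at every `(U, δ)`: ground-floor `d`-wave order of `(N_L, 0)` reaches the `(N_L - 2, 0)`
floor — floor order ⇒ the crux's ground-floor pair bridge.  (c0's window input `SymmetricWindowInputsApprox` is a
SUFFICIENT condition, `floorOrderBridges_of_symmetricWindowInputsApprox`; unlike it, (R2') is also NECESSARY.) -/
def FloorOrderBridges : Prop :=
  ∀ (U δ : ℝ), 0 < U → δ ∈ Set.Ioo (0:ℝ) (1 / 2) → FloorOrder U δ → FloorBridge U δ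

/-- stub (R2'): floor order bridges to the adjacent floor (tower-collision exclusion; model statement).
Registered Theorems-level form: `floorBridge_of_floorOrder` (same statement spelled out; this stub closes from it by
`exact`).  Wave 1 (lead c1, stub-worker): `stub-blocked` — no tree declaration bounds the `(N_L - 2, 0)` spectrum of
`hubbardTorus 2 L 1 U` from BELOW as seen by `Δ_d G(N_L)` (every KT/LRO tool gives UPPER bounds on gaps; the JmPairBridge
floor files take the in-sector gap as a hypothesis); the missing model fact is the hypothesis `hR` of
`Theorems.JosephsonMirror.symmetricWindowInputs_of_divergentLLO` (low-lying orthogonality at a divergent scale), from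
which this stub follows in three lines (`symmetricWindowInputs_of_divergentLLO` + `bridgeFromFloorOrder`). -/
theorem stub_floorOrderBridges : FloorOrderBridges := by
  sorry

/-- c0's approximate window inputs imply (R2') (engine `bridgeFromFloorOrderApprox`, p110900). -/
theorem floorOrderBridges_of_symmetricWindowInputsApprox (h₃ : SymmetricWindowInputsApprox) :
    FloorOrderBridges := by
  intro U δ hU hδ hF
  obtain ⟨γ, hγ, hlow, hch⟩ := h₃ U δ hU hδ hF
  exact stub_bridgeFromFloorOrderApprox U δ hU hδ γ hγ hlow hch hF

/-- A ground state has zero excess: floor order is zero-excess pair order (with `n = N_L`, `v = g`). -/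
theorem zepo_of_floorOrder (U δ : ℝ) (hF : FloorOrder U δ) : ZeroExcessPairOrder U δ := by
  obtain ⟨c, hc, L₀, hL₀⟩ := hF
  refine ⟨c, hc, fun ε hε => ⟨L₀, fun L _ hE hL => ?_⟩⟩
  obtain ⟨g, hg, hg1, hord⟩ := hL₀ L hE hL
  refine ⟨statN δ L, Or.inl rfl, g, hg.1, hg1, ?_, hord⟩
  have hev := hg.2.2
  have hre : (star g ⬝ᵥ (hubbardTorus 2 L 1 U *ᵥ g)).re =
      (hubbardTorus 2 L 1 U).minEnergyOn (szSector (statN δ L) 0) := by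
    rw [hev, dotProduct_smul, hg1, smul_eq_mul, mul_one, Complex.ofReal_re]
  rw [hre]
  have : 0 ≤ ε * (L : ℝ) ^ 2 := by positivity
  linarith

/-- SUFFICIENCY: (R1) and (R2') give the single-layer form, hence the crux (normal form, p126545). -/
theorem jmInterchange_of_reachesFloor_of_bridges (h₂ : ZeroExcessOrderReachesFloor) (h₃ : FloorOrderBridges) :
    JmInterchange := by
  rw [JmInterchange_iff_singleLayerForm]
  intro U δ hU hδ hZ
  exact h₃ U δ hU hδ (h₂ U δ hU hδ hZ)

/-- NECESSITY of (R1): tree theorem `floorOrder_of_zeroExcessPairOrder_of_jmInterchange` (p126771). -/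
theorem zepoReachesFloor_of_jmInterchange (hJ : JmInterchange) : ZeroExcessOrderReachesFloor := by
  intro U δ hU hδ hZ
  exact Summit.HubbardSuperconductivity.HubbardSuperconductivity.Theorems.JosephsonMirror.floorOrder_of_zeroExcessPairOrder_of_jmInterchange
    hJ U δ hU hδ hZ

/-- NECESSITY of (R2'): floor order is zero-excess order, and the crux in single-layer form bridges it. -/
theorem floorOrderBridges_of_jmInterchange (hJ : JmInterchange) : FloorOrderBridges := by
  intro U δ hU hδ hF
  exact (JmInterchange_iff_singleLayerForm.mp hJ) U δ hU hδ (zepo_of_floorOrder U δ hF)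

/-- THE EXACT NORMAL FORM of the crux: `JmInterchange ↔ (R1 ∧ R2')`.  LANDED (p127245) as the tree theorem
`Theorems.JosephsonMirror.jmInterchange_iff_reachesFloor_and_bridges` (Theorems/JosephsonMirrorJmInterchangeExactResidues.lean,
statements spelled out); here by the local lemmas. -/
theorem jmInterchange_iff_residues : JmInterchange ↔ (ZeroExcessOrderReachesFloor ∧ FloorOrderBridges) :=
  ⟨fun h => ⟨zepoReachesFloor_of_jmInterchange h, floorOrderBridges_of_jmInterchange h⟩,
    fun h => jmInterchange_of_reachesFloor_of_bridges h.1 h.2⟩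

/-- The same normal form, read off the tree theorem (consistency check of the spelled-out signatures). -/
theorem jmInterchange_iff_residues' : JmInterchange ↔ (ZeroExcessOrderReachesFloor ∧ FloorOrderBridges) :=
  Summit.HubbardSuperconductivity.HubbardSuperconductivity.Theorems.JosephsonMirror.jmInterchange_iff_reachesFloor_and_bridges

/-! ## §4 Composition -/

/-- COMPOSITION (logic, c0 form): the pieces conclude the crux BY NAME (approximate-orthogonality form). -/
theorem jmInterchange_of (h₁ : HypGivesZEPO) (h₂ : ZeroExcessOrderReachesFloor)
    (h₃ : SymmetricWindowInputsApprox) (h₄ : BridgeFromFloorOrderApprox) : JmInterchange := by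
  rw [jmInterchange_iff_pointwise]
  intro U δ a J₀ hU hδ ha hJ₀ hG
  have hF : FloorOrder U δ := h₂ U δ hU hδ (h₁ U δ a J₀ hU hδ ha hJ₀ hG)
  obtain ⟨γ, hγ, hlow, hch⟩ := h₃ U δ hU hδ hF
  exact h₄ U δ hU hδ γ hγ hlow hch hF

/-- The crux, modulo the registered stubs (R1) `stub_zepoReachesFloor` and (R2') `stub_floorOrderBridges`. -/
theorem JmInterchange_of : JmInterchange :=
  jmInterchange_of_reachesFloor_of_bridges stub_zepoReachesFloor stub_floorOrderBridges


/-! ## §5 (lead c2) The interchange in RATE form — closed -/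

/-- TWO-SECTOR ISOLATION at `(U, δ)` and scale `γ_L`: eventually in even `L`, for `n ∈ {N_L, N_L - 2}`, every vector of
`szSector n 0` orthogonal to the sector ground floor has energy `≥ e(n) + γ_L`. -/
def TwoSectorIsolation (U δ : ℝ) (γ : ℕ → ℝ) : Prop :=
  ∃ L₀ : ℕ, ∀ (L : ℕ) [NeZero L], Even L → L₀ ≤ L →
    ∀ n : ℕ, (n = statN δ L ∨ n = statN δ L - 2) → ∀ w : Fock (Orb (FermionTorus 2 L)), w ∈ szSector n 0 →
      (∀ g : Fock (Orb (FermionTorus 2 L)), IsGroundStateInSector (hubbardTorus 2 L 1 U) n 0 g → star g ⬝ᵥ w = 0) →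
        ((hubbardTorus 2 L 1 U).minEnergyOn (szSector n 0) + γ L) * (star w ⬝ᵥ w).re ≤
          (star w ⬝ᵥ (hubbardTorus 2 L 1 U *ᵥ w)).re

/-- MESOSCOPIC JOSEPHSON GAIN at `(U, δ)`: eventually in even `L` the window double of the crux (verbatim objects) gains
`a J_L L² ≤ E_L(0) - E_L(J_L)` at the couplings `J_L`. -/
def MesoscopicGain (U δ a : ℝ) (J : ℕ → ℝ) : Prop :=
  ∃ L₀ : ℕ, ∀ (L : ℕ) [NeZero L], Even L → L₀ ≤ L → (let ι : Type := Finset (Literature.MathematicalPhysics.QuantumLattice.Orb (Literature.MathematicalPhysics.QuantumLattice.FermionTorus 2 L)); let N : ℕ := 2 * ⌊(1 - δ) * (L : ℝ) ^ 2 / 2⌋₊; let H : Matrix ι ι ℂ := Literature.MathematicalPhysics.QuantumLattice.hubbardTorus 2 L 1 U; let μ : ℝ := (H.minEnergyOn (Literature.MathematicalPhysics.QuantumLattice.szSector N 0) - H.minEnergyOn (Literature.MathematicalPhysics.QuantumLattice.szSector (N - 2) 0)) / 2; let A : Matrix ι ι ℂ := Literature.MathematicalPhysics.QuantumLattice.hubbardTorusWith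 2 L 1 U μ; let D : Matrix ι ι ℂ := ((L : ℂ))⁻¹ • Literature.MathematicalPhysics.QuantumLattice.pairField Literature.MathematicalPhysics.QuantumLattice.dWaveFormFactor L; let Hd : ℝ → Matrix (ι × ι) (ι × ι) ℂ := fun J => Matrix.kroneckerMap (fun a b : ℂ => a * b) A 1 + Matrix.kroneckerMap (fun a b : ℂ => a * b) 1 (Matrix.transpose A) - (J : ℂ) • (Matrix.kroneckerMap (fun a b : ℂ => a * b) D (Matrix.transpose (Matrix.conjTranspose D)) + Matrix.kroneckerMap (fun a b : ℂ => a * b) (Matrix.conjTranspose D) (Matrix.transpose D)); let good : ι × ι → Prop := fun p => ((p.1.card = N ∧ p.2.card = N) ∨ (p.1.card = N - 2 ∧ p.2.card = N - 2)) ∧ (p.1.filter (fun o => (ofLex o).2 = 0)).card = (p.1.filter (fun o => (ofLex o).2 = 1)).card ∧ (p.2.filter (fun o => (ofLex o).2 = 0)).card = (p.2.filter (fun o => (ofLex o).2 = 1)).card; let S : Submodule ℂ (ι × ι → ℂ) := ⨅ (p : ι × ι) (_ : ¬ good p), LinearMap.ker (LinearMap.proj (R := ℂ) (φ := fun _ :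 ι × ι => ℂ) p); let E : ℝ → ℝ := fun J => (Hd J).minEnergyOn S; a * J L * (L : ℝ) ^ 2 ≤ E 0 - E (J L))

/-- CLOSED (p129634, tree theorem `Theorems.JosephsonMirror.rateFormInterchange`): the interchange in rate form —
two-sector isolation at scale `γ_L` plus mesoscopic Josephson gain at couplings `J_L > 0` with `J_L L² / γ_L → 0` give the
crux's CONCLUSION `FloorBridge U δ` (with `a' = a/4`).  The converse (floor bridge ⇒ gain for all `J ≥ 0`, uniform onset) is
`jmPairBridgeGivesGain_proof`. -/
theorem floorBridge_of_mesoscopicGain_of_isolation (U δ a : ℝ) (J γ : ℕ → ℝ) (hδ : δ ∈ Set.Ioo (0:ℝ) (1 / 2))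
    (ha : 0 < a) (hJ : ∀ L, 0 < J L) (hγ : ∀ L, 0 < γ L)
    (hsmall : Tendsto (fun L : ℕ => J L * (L : ℝ) ^ 2 / γ L) atTop (nhds 0))
    (hiso : TwoSectorIsolation U δ γ) (hgain : MesoscopicGain U δ a J) : FloorBridge U δ :=
  Summit.HubbardSuperconductivity.HubbardSuperconductivity.Theorems.JosephsonMirror.rateFormInterchange U δ a J γ hδ ha hJ
    hγ hsmall hiso hgain

/-! ## §6 (lead c3) The onset-upgrade normal form and the negative lemma — both in the tree -/

/-- UNIFORM-ONSET gain at `(U, δ, a')` for ALL `J ≥ 0`: one onset `L₀` serves every coupling. -/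
def UniformGainAllJ (U δ a' : ℝ) : Prop :=
  ∃ L₀ : ℕ, ∀ J : ℝ, 0 ≤ J → ∀ (L : ℕ) [NeZero L], Even L → L₀ ≤ L → (let ι : Type := Finset (Literature.MathematicalPhysics.QuantumLattice.Orb (Literature.MathematicalPhysics.QuantumLattice.FermionTorus 2 L)); let N : ℕ := 2 * ⌊(1 - δ) * (L : ℝ) ^ 2 / 2⌋₊; let H : Matrix ι ι ℂ := Literature.MathematicalPhysics.QuantumLattice.hubbardTorus 2 L 1 U; let μ : ℝ := (H.minEnergyOn (Literature.MathematicalPhysics.QuantumLattice.szSector N 0) - H.minEnergyOn (Literature.MathematicalPhysics.QuantumLattice.szSector (N - 2) 0)) / 2; let A : Matrix ι ι ℂ := Literature.MathematicalPhysics.QuantumLattice.hubbardTorusWith 2 L 1 U μ; let D : Matrix ι ι ℂ := ((L : ℂ))⁻¹ • Literature.MathematicalPhysics.QuantumLattice.pairField Literature.MathematicalPhysics.QuantumLattice.dWaveFormFactor L; let Hd : ℝ → Matrix (ι × ι) (ι × ι) ℂ := fun J => Matrix.kroneckerMap (fun a b : ℂ => a * b) A 1 + Matrix.kroneckerMap (fun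 a b : ℂ => a * b) 1 (Matrix.transpose A) - (J : ℂ) • (Matrix.kroneckerMap (fun a b : ℂ => a * b) D (Matrix.transpose (Matrix.conjTranspose D)) + Matrix.kroneckerMap (fun a b : ℂ => a * b) (Matrix.conjTranspose D) (Matrix.transpose D)); let good : ι × ι → Prop := fun p => ((p.1.card = N ∧ p.2.card = N) ∨ (p.1.card = N - 2 ∧ p.2.card = N - 2)) ∧ (p.1.filter (fun o => (ofLex o).2 = 0)).card = (p.1.filter (fun o => (ofLex o).2 = 1)).card ∧ (p.2.filter (fun o => (ofLex o).2 = 0)).card = (p.2.filter (fun o => (ofLex o).2 = 1)).card; let S : Submodule ℂ (ι × ι → ℂ) := ⨅ (p : ι × ι) (_ : ¬ good p), LinearMap.ker (LinearMap.proj (R := ℂ) (φ := fun _ : ι × ι => ℂ) p); let E : ℝ → ℝ := fun J => (Hd J).minEnergyOn S; a' * J * (L : ℝ) ^ 2 ≤ E 0 - E J)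

/-- CLOSED (p137538, tree theorem `Theorems.JosephsonMirror.jmInterchange_iff_onsetUpgrade`): the crux is EXACTLY the
onset upgrade — pointwise-onset gain (`GainHyp`, the filed hypothesis) ⇒ uniform-onset gain for all `J ≥ 0`, at every
`(U, δ, a, J₀)`.  Read with `jmInterchange_iff_residues`: interchanging `∀ J ∃ L₀` with `∃ L₀ ∀ J` IS (R1 ∧ R2'). -/
theorem jmInterchange_iff_onsetUpgrade' :
    JmInterchange ↔ ∀ (U δ a J₀ : ℝ), 0 < U → δ ∈ Set.Ioo (0:ℝ) (1 / 2) → 0 < a → 0 < J₀ →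
      GainHyp U δ a J₀ → ∃ a' : ℝ, 0 < a' ∧ UniformGainAllJ U δ a' :=
  Summit.HubbardSuperconductivity.HubbardSuperconductivity.Theorems.JosephsonMirror.jmInterchange_iff_onsetUpgrade

/-- CLOSED (p137666, tree theorem `JmInterchangeNegative.JmInterchange_false_of_ZepoFloorMismatch`): the negative lemma
modulo `ZepoFloorMismatch` (zero-excess pair order at a point + adjacent-floor symmetry mismatch infinitely often). -/
theorem jmInterchange_false_of_zepoFloorMismatch
    (hH : Summit.HubbardSuperconductivity.JmInterchangeNegative.ZepoFloorMismatch) : ¬ JmInterchange :=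
  Summit.HubbardSuperconductivity.JmInterchangeNegative.JmInterchange_false_of_ZepoFloorMismatch hH

/-! ## §8 (lead c5) The coupling range `J₀` of the hypothesis is idle — in the tree -/

/-- The hypothesis at range `J₀` gives the hypothesis at ANY range `J₀'`, same constant `a` (p141101,
`Theorems.JosephsonMirror.gainHyp_mono_range`: concavity of `E_L` ⇒ the secant slope `(E_L(0) − E_L(J))/J` is non-decreasing). -/
theorem gainHyp_mono_range' (U δ a J₀ J₀' : ℝ) (hJ₀ : 0 < J₀) (hG : GainHyp U δ a J₀) : GainHyp U δ a J₀' :=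
  Summit.HubbardSuperconductivity.HubbardSuperconductivity.Theorems.JosephsonMirror.gainHyp_mono_range U δ a J₀ J₀' hJ₀ hG

/-- CLOSED (p141101, tree theorem `Theorems.JosephsonMirror.jmInterchange_iff_unitRange`): the crux is its own instance
`J₀ = 1` — `JmInterchange ↔ ∀ (U, δ, a), GainHyp U δ a 1 → FloorBridge U δ`. -/
theorem jmInterchange_iff_unitRange' :
    JmInterchange ↔ ∀ (U δ a : ℝ), 0 < U → δ ∈ Set.Ioo (0:ℝ) (1 / 2) → 0 < a → GainHyp U δ a 1 → FloorBridge U δ :=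
  Summit.HubbardSuperconductivity.HubbardSuperconductivity.Theorems.JosephsonMirror.jmInterchange_iff_unitRange

end

end Summit.HubbardSuperconductivity.HubbardSuperconductivity.Cruxes.JmInterchange.Sketch
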